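import Summits.ValiantsHypothesis.ValiantsHypothesis.Theorems.MatrixDescartes.Negative.MatrixDescartesFalseOfTropicalMonster
import Summits.ValiantsHypothesis.ValiantsHypothesis.Theorems.KPlusLogSqLawTropicalBIncidenceCodes

/-!
# Route «KPlusLogSqLaw», crux `TropicalB` (stmt-ValiantsHypothesis-19771) — GENERIC PERTURBATION: every design becomes 4-generic, keeping dominance

HONEST FRAMING.  Helper toward the registered stubs `stub_tropThin` / `stub_tropFat` of `Cruxes/TropicalB/Lines/birth.lean` (crux
`Summit.ValiantsHypothesis.ValiantsHypothesis.Theses.KPlusLogSqLaw.TropicalB`, item stmt-ValiantsHypothesis-19771, route KPlusLogSqLaw; cell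
`pub-symmetroid`, seat val-sym-trop-p1 g25, 2026-08-29; `--supports … --as helper`).  Part 2b of the SINGLE-ORBIT / TIGHT NORMAL FORM of the unsigned
row `TropRowD`: a perturbation lemma about ONE design; nothing here bounds `TropicalB` in its window and nothing bears on `WeakLifting`, DoorA26 /
DoorA34, `MatrixDescartes` (stmt-ValiantsHypothesis-18050) or VP ≠ VNP.

For a term `q = (σ, λ)` write `sl q = Σ_b d(λ b)` and `V q = Σ_b v(σ b, b, λ b)` (`tropWeight d v θ q = θ·sl q − V q`).  Recall (part 1,
`…TropicalBTightRefinement`) that `(d, v, ε)` is 4-GENERIC if (G1) distinct present terms with equal `sl` have different `V`, (G2) no three present terms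
with pairwise distinct `sl` are collinear as points `(sl, V)`, (G3) every tie slope `(V q' − V q)/(sl q' − sl q)` (`sl q < sl q'`, both present) is an
integer divisible by `4`.

* `GenericPerturbation.exists_generic` — **for every design `(d, v, ε)` of format `(m, K)` there are valuations `v'` and an integer `c > 0` such that
  `(d, v', ε)` is 4-generic and every term dominant at a slope `θ` for `(d, v, ε)` is dominant at `c·θ` for `(d, v', ε)`** (same exponents, same
  support, same signs).  Construction: `v' = L·(N·v + B^code)` with an injective incidence code, base `B = m·Σd + 3`, `N` exceeding twice the product
  of the slope range `m·Σd` and the code-sum range `m·B^T`, and `L = 4·(m·Σd)!`; (G1)/(G2) by `…TropicalBIncidenceCodes.eq_of_codeSum_eq` /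
  `eq_of_three_term_relation` after reducing modulo the large factor `N`, (G3) because every slope difference divides `(m·Σd)!`, dominance because the
  integer margin `1` becomes `N >` every code sum.
[folklore: perturbation of a point configuration into general position by independent small generic weights; here with explicit integers]
-/

set_option linter.dupNamespace false
set_option autoImplicit false

namespace Summit.ValiantsHypothesis.ValiantsHypothesis.Theorems.KPlusLogSqLaw

open Summit.ValiantsHypothesis.ValiantsHypothesis.Theorems.MatrixDescartes.Negative
open scoped BigOperators
open Finset

namespace GenericPerturbation

variable {m K : ℕ}

/-- an injective code of the incidences `(a, b, l)` by naturals below `T = m²K`. [folklore] -/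
theorem exists_injective_code (m K : ℕ) : ∃ (T : ℕ) (code : Fin m → Fin m → Fin K → ℕ),
    (∀ a b l a' b' l', code a b l = code a' b' l' → a = a' ∧ b = b' ∧ l = l') ∧ (∀ a b l, code a b l < T) := by
  refine ⟨Fintype.card (Fin m × Fin m × Fin K), fun a b l => (Fintype.equivFin (Fin m × Fin m × Fin K) (a, b, l) : ℕ), ?_,
    fun a b l => (Fintype.equivFin _ (a, b, l)).isLt⟩
  intro a b l a' b' l' h
  have h1 : (Fintype.equivFin (Fin m × Fin m × Fin K) (a, b, l)) = Fintype.equivFin _ (a', b', l') := Fin.ext h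
  have h2 := (Fintype.equivFin (Fin m × Fin m × Fin K)).injective h1
  simp only [Prod.mk.injEq] at h2
  exact ⟨h2.1, h2.2.1, h2.2.2⟩

/-- **Generic perturbation.**  Every design `(d, v, ε)` admits valuations `v'` and a scale `c > 0` such that `(d, v', ε)` is 4-generic
((G1), (G2), (G3) in the inline form of `TightChain.exists_step`) and dominance at `θ` for `v` implies dominance at `c·θ` for `v'`. [folklore] -/
theorem exists_generic (d : Fin K → ℕ) (v ε : Fin m → Fin m → Fin K → ℤ) :
    ∃ (v' : Fin m → Fin m → Fin K → ℤ) (c : ℤ), 0 < c ∧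
      (∀ (θ : ℤ) (q : Equiv.Perm (Fin m) × (Fin m → Fin K)), IsDominant d v ε θ q → IsDominant d v' ε (c * θ) q) ∧
      (∀ q q' : Equiv.Perm (Fin m) × (Fin m → Fin K), termSign ε q ≠ 0 → termSign ε q' ≠ 0 → q ≠ q' →
        (∑ i, (d (q.2 i) : ℤ)) = ∑ i, (d (q'.2 i) : ℤ) → (∑ i, v' (q.1 i) i (q.2 i)) ≠ ∑ i, v' (q'.1 i) i (q'.2 i)) ∧
      (∀ q₁ q₂ q₃ : Equiv.Perm (Fin m) × (Fin m → Fin K), termSign ε q₁ ≠ 0 → termSign ε q₂ ≠ 0 → termSign ε q₃ ≠ 0 →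
        (∑ i, (d (q₁.2 i) : ℤ)) < ∑ i, (d (q₂.2 i) : ℤ) → (∑ i, (d (q₂.2 i) : ℤ)) < ∑ i, (d (q₃.2 i) : ℤ) →
        ((∑ i, (d (q₂.2 i) : ℤ)) - ∑ i, (d (q₁.2 i) : ℤ)) * ((∑ i, v' (q₃.1 i) i (q₃.2 i)) - ∑ i, v' (q₁.1 i) i (q₁.2 i)) ≠
          ((∑ i, (d (q₃.2 i) : ℤ)) - ∑ i, (d (q₁.2 i) : ℤ)) * ((∑ i, v' (q₂.1 i) i (q₂.2 i)) - ∑ i, v' (q₁.1 i) i (q₁.2 i))) ∧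
      (∀ q q' : Equiv.Perm (Fin m) × (Fin m → Fin K), termSign ε q ≠ 0 → termSign ε q' ≠ 0 →
        (∑ i, (d (q.2 i) : ℤ)) < ∑ i, (d (q'.2 i) : ℤ) →
        ∃ ψ : ℤ, (∑ i, v' (q'.1 i) i (q'.2 i)) - (∑ i, v' (q.1 i) i (q.2 i)) =
          ψ * ((∑ i, (d (q'.2 i) : ℤ)) - ∑ i, (d (q.2 i) : ℤ)) ∧ 4 ∣ ψ) := by
  classical
  -- (0) an injective code of the incidences
  obtain ⟨T, code, hcode_inj, hcode_lt⟩ := exists_injective_code m K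
  -- (1) slopes lie in `[0, m·D]`
  obtain ⟨sl, hsl⟩ : ∃ sl : (Equiv.Perm (Fin m) × (Fin m → Fin K)) → ℤ, ∀ q, sl q = ∑ i, (d (q.2 i) : ℤ) := ⟨_, fun _ => rfl⟩
  obtain ⟨D, hD⟩ : ∃ D : ℕ, D = ∑ l, d l := ⟨_, rfl⟩
  have hsl_nn : ∀ q, 0 ≤ sl q := fun q => by rw [hsl]; positivity
  have hsl_le : ∀ q, sl q ≤ (m : ℤ) * D := by
    intro q
    rw [hsl]
    calc (∑ i, (d (q.2 i) : ℤ)) ≤ ∑ _i : Fin m, (D : ℤ) := by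
          refine sum_le_sum fun i _ => ?_
          rw [hD]; push_cast
          exact single_le_sum (f := fun l => (d l : ℤ)) (fun l _ => by positivity) (mem_univ (q.2 i))
      _ = (m : ℤ) * D := by rw [sum_const, card_univ, Fintype.card_fin, nsmul_eq_mul]
  -- (2) the base and the code sums
  obtain ⟨B, hB⟩ : ∃ B : ℕ, B = m * D + 3 := ⟨_, rfl⟩
  have hB3 : 3 ≤ B := by omega
  have hB1 : (1 : ℤ) ≤ (B : ℤ) := by exact_mod_cast (show 1 ≤ B by omega)
  obtain ⟨η, hη⟩ : ∃ η : (Equiv.Perm (Fin m) × (Fin m → Fin K)) → ℤ, ∀ q, η q = ∑ i, (B : ℤ) ^ code (q.1 i) i (q.2 i) :=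
    ⟨_, fun _ => rfl⟩
  have hη_nn : ∀ q, 0 ≤ η q := fun q => by rw [hη]; positivity
  have hη_le : ∀ q, η q ≤ (m : ℤ) * (B : ℤ) ^ T := by
    intro q
    rw [hη]
    calc (∑ i, (B : ℤ) ^ code (q.1 i) i (q.2 i)) ≤ ∑ _i : Fin m, (B : ℤ) ^ T :=
          sum_le_sum fun i _ => pow_le_pow_right₀ hB1 (hcode_lt _ _ _).le
      _ = (m : ℤ) * (B : ℤ) ^ T := by rw [sum_const, card_univ, Fintype.card_fin, nsmul_eq_mul]
  -- (3) the large factor `N` and the first perturbation `v₁ = N·v + B^code`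
  obtain ⟨N, hN⟩ : ∃ N : ℤ, N = 2 * ((m : ℤ) * D + 1) * ((m : ℤ) * (B : ℤ) ^ T + 1) + 1 := ⟨_, rfl⟩
  have hmD : (0 : ℤ) ≤ (m : ℤ) * D := by positivity
  have hmB : (0 : ℤ) ≤ (m : ℤ) * (B : ℤ) ^ T := by positivity
  have hN0 : 0 < N := by rw [hN]; nlinarith
  have hηN : ∀ q, η q < N := fun q => by rw [hN]; nlinarith [hη_le q]
  have hsmall : ∀ x R : ℤ, N * x = R → |R| < N → x = 0 := by
    intro x R h hR
    by_contra hx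
    have h1 : (1 : ℤ) ≤ |x| := Int.one_le_abs hx
    have h2 : N ≤ |R| := by rw [← h, abs_mul, abs_of_pos hN0]; nlinarith
    linarith
  obtain ⟨v₁, hv₁⟩ : ∃ v₁ : Fin m → Fin m → Fin K → ℤ, ∀ a b l, v₁ a b l = N * v a b l + (B : ℤ) ^ code a b l :=
    ⟨_, fun _ _ _ => rfl⟩
  obtain ⟨V, hV⟩ : ∃ V : (Equiv.Perm (Fin m) × (Fin m → Fin K)) → ℤ, ∀ q, V q = ∑ i, v (q.1 i) i (q.2 i) := ⟨_, fun _ => rfl⟩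
  have hV₁ : ∀ q : Equiv.Perm (Fin m) × (Fin m → Fin K), (∑ i, v₁ (q.1 i) i (q.2 i)) = N * V q + η q := by
    intro q
    rw [hV, hη, mul_sum, ← sum_add_distrib]
    exact sum_congr rfl fun i _ => by rw [hv₁]
  -- (4) the common denominator `L = 4·(m·D)!` and the final valuations
  obtain ⟨M, hM⟩ : ∃ M : ℕ, M = m * D := ⟨_, rfl⟩
  obtain ⟨L, hL⟩ : ∃ L : ℤ, L = 4 * ((Nat.factorial M : ℕ) : ℤ) := ⟨_, rfl⟩
  have hL0 : 0 < L := by rw [hL]; have := Nat.factorial_pos M; positivity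
  obtain ⟨v', hv'⟩ : ∃ v' : Fin m → Fin m → Fin K → ℤ, ∀ a b l, v' a b l = L * v₁ a b l := ⟨_, fun _ _ _ => rfl⟩
  have hV' : ∀ q : Equiv.Perm (Fin m) × (Fin m → Fin K), (∑ i, v' (q.1 i) i (q.2 i)) = L * (N * V q + η q) := by
    intro q
    rw [← hV₁, mul_sum]
    exact sum_congr rfl fun i _ => by rw [hv']
  have hw : ∀ (w : Fin m → Fin m → Fin K → ℤ) θ (q : Equiv.Perm (Fin m) × (Fin m → Fin K)),
      tropWeight d w θ q = θ * sl q - ∑ i, w (q.1 i) i (q.2 i) := fun w θ q => by rw [hsl]; rfl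
  refine ⟨v', L * N, mul_pos hL0 hN0, ?_, ?_, ?_, ?_⟩
  · -- dominance survives: the integer margin `1` becomes `N > η`
    intro θ q hq
    refine ⟨hq.1, fun r hrq hr => ?_⟩
    have hlt := hq.2 r hrq hr
    rw [hw, hw, ← hV, ← hV] at hlt
    rw [hw, hw, hV', hV']
    have h1 : θ * sl r - V r + 1 ≤ θ * sl q - V q := hlt
    have h2 := hηN q
    have h3 := hη_nn r
    have h4 : N * (θ * sl r - V r) - η r < N * (θ * sl q - V q) - η q := by nlinarith
    have h5 : L * (N * (θ * sl r - V r) - η r) < L * (N * (θ * sl q - V q) - η q) := mul_lt_mul_of_pos_left h4 hL0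
    nlinarith
  · -- (G1)
    intro q q' _ _ hqq' _ heq
    simp only [← hsl] at *
    rw [hV', hV'] at heq
    have h1 : N * V q + η q = N * V q' + η q' := mul_left_cancel₀ hL0.ne' heq
    have h2 : N * (V q - V q') = η q' - η q := by linarith
    have h3 : |η q' - η q| < N := by
      rw [abs_lt]; constructor <;> nlinarith [hη_nn q, hη_nn q', hηN q, hηN q']
    have h4 := hsmall _ _ h2 h3
    have h5 : η q = η q' := by rw [h4, mul_zero] at h2; linarith
    rw [hη, hη] at h5
    exact hqq' (TightChain.eq_of_codeSum_eq code hcode_inj T hcode_lt B hB3 q q' h5)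
  · -- (G2)
    intro q₁ q₂ q₃ _ _ _ h12 h23 heq
    simp only [← hsl] at *
    rw [hV', hV', hV'] at heq
    -- cancel `L`, then reduce modulo the large factor `N`
    have h1 : (sl q₂ - sl q₁) * (N * V q₃ + η q₃ - (N * V q₁ + η q₁)) = (sl q₃ - sl q₁) * (N * V q₂ + η q₂ - (N * V q₁ + η q₁)) := by
      have : L * ((sl q₂ - sl q₁) * (N * V q₃ + η q₃ - (N * V q₁ + η q₁))) =
          L * ((sl q₃ - sl q₁) * (N * V q₂ + η q₂ - (N * V q₁ + η q₁))) := by linear_combination heq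
      exact mul_left_cancel₀ hL0.ne' this
    have h2 : N * ((sl q₂ - sl q₁) * (V q₃ - V q₁) - (sl q₃ - sl q₁) * (V q₂ - V q₁)) =
        (sl q₃ - sl q₁) * (η q₂ - η q₁) - (sl q₂ - sl q₁) * (η q₃ - η q₁) := by linear_combination h1
    have hR : |(sl q₃ - sl q₁) * (η q₂ - η q₁) - (sl q₂ - sl q₁) * (η q₃ - η q₁)| < N := by
      have ha : |sl q₃ - sl q₁| ≤ (m : ℤ) * D := by
        rw [abs_le]; constructor <;> linarith [hsl_nn q₁, hsl_nn q₃, hsl_le q₁, hsl_le q₃]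
      have hb : |sl q₂ - sl q₁| ≤ (m : ℤ) * D := by
        rw [abs_le]; constructor <;> linarith [hsl_nn q₁, hsl_nn q₂, hsl_le q₁, hsl_le q₂]
      have hc : |η q₂ - η q₁| ≤ (m : ℤ) * (B : ℤ) ^ T := by
        rw [abs_le]; constructor <;> linarith [hη_nn q₁, hη_nn q₂, hη_le q₁, hη_le q₂]
      have hd : |η q₃ - η q₁| ≤ (m : ℤ) * (B : ℤ) ^ T := by
        rw [abs_le]; constructor <;> linarith [hη_nn q₁, hη_nn q₃, hη_le q₁, hη_le q₃]
      calc |(sl q₃ - sl q₁) * (η q₂ - η q₁) - (sl q₂ - sl q₁) * (η q₃ - η q₁)|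
          ≤ |(sl q₃ - sl q₁) * (η q₂ - η q₁)| + |(sl q₂ - sl q₁) * (η q₃ - η q₁)| := abs_sub _ _
        _ = |sl q₃ - sl q₁| * |η q₂ - η q₁| + |sl q₂ - sl q₁| * |η q₃ - η q₁| := by rw [abs_mul, abs_mul]
        _ ≤ (m : ℤ) * D * ((m : ℤ) * (B : ℤ) ^ T) + (m : ℤ) * D * ((m : ℤ) * (B : ℤ) ^ T) :=
            add_le_add (mul_le_mul ha hc (abs_nonneg _) hmD) (mul_le_mul hb hd (abs_nonneg _) hmD)
        _ < N := by rw [hN]; nlinarith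
    have h3 := hsmall _ _ h2 hR
    have h4 : (sl q₃ - sl q₁) * (η q₂ - η q₁) - (sl q₂ - sl q₁) * (η q₃ - η q₁) = 0 := by rw [h3, mul_zero] at h2; linarith
    -- the three-term relation `α η₃ + β η₁ = (α+β) η₂` with `α = sl₂ − sl₁`, `β = sl₃ − sl₂`
    have h5 : (sl q₂ - sl q₁) * η q₃ + (sl q₃ - sl q₂) * η q₁ = ((sl q₂ - sl q₁) + (sl q₃ - sl q₂)) * η q₂ := by
      linear_combination (-1 : ℤ) * h4
    rw [hη, hη, hη] at h5
    have hαβ : (sl q₂ - sl q₁) + (sl q₃ - sl q₂) + 3 ≤ (B : ℤ) := by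
      rw [hB]; push_cast; linarith [hsl_nn q₁, hsl_le q₃]
    obtain ⟨h12', _⟩ := TightChain.eq_of_three_term_relation code hcode_inj T hcode_lt B _ _ (by linarith) (by linarith) hαβ q₁ q₂ q₃ h5
    rw [h12'] at h12
    exact lt_irrefl _ h12
  · -- (G3)
    intro q q' _ _ hlt
    simp only [← hsl] at *
    rw [hV', hV']
    have hs1 : 1 ≤ sl q' - sl q := by linarith
    have hsM : sl q' - sl q ≤ (M : ℤ) := by rw [hM]; push_cast; linarith [hsl_nn q, hsl_le q']
    -- the slope difference divides `M!`
    have hdvdN : (sl q' - sl q).toNat ∣ Nat.factorial M :=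
      Nat.dvd_factorial (by omega) (by omega)
    have hdvd : (sl q' - sl q) ∣ ((Nat.factorial M : ℕ) : ℤ) := by
      have h := Int.natCast_dvd_natCast.mpr hdvdN
      rwa [Int.toNat_of_nonneg (by linarith)] at h
    obtain ⟨e, he⟩ := hdvd
    refine ⟨4 * e * (N * V q' + η q' - (N * V q + η q)), ?_, ⟨e * (N * V q' + η q' - (N * V q + η q)), by ring⟩⟩
    rw [hL, he]; ring

end GenericPerturbation

end Summit.ValiantsHypothesis.ValiantsHypothesis.Theorems.KPlusLogSqLaw
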